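import Literature.NumberTheory.Automorphic.WhittakerMajorantInputs
import Literature.NumberTheory.Automorphic.WhittakerDecayCuspForm
import Literature.NumberTheory.Automorphic.CuspFormFourierExpansionGLn
import Literature.NumberTheory.Automorphic.CuspFormsRapidDecayLevel
import Literature.NumberTheory.Automorphic.UnipotentCosetTower
import HarnessLib

/-!
# Absolute convergence of the Fourier–Whittaker expansion of a cusp form on `GL_n(𝔸_K)`

Topic `NumberTheory/Automorphic`; namespace `Literature.NumberTheory.Automorphic`. Proof file
(theorems only). We PROVE the absolute summability of the Whittaker series of a cusp form,

  `∑_{γ ∈ N_{n-1}(K)\GL_{n-1}(K)} ‖W_φ(diag(γ, 1) x)‖ < ∞`   (`IsCuspFormGL.summable_norm_whittakerDepth_glCorner`),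

for every cusp form `φ` on `GL_n(𝔸_K)` over a number field (Borel–Jacquet conditions, no central
character assumed) and every `x ∈ GL_n(𝔸_K)`, and deduce the named fact
`Shalika1974_fourierExpansion_cuspForm` of `GlobalWhittakerCoefficient` (the Fourier–Whittaker
expansion `φ(g) = ∑_γ W_φ(diag(γ,1) g)`, Shalika (1974), Thm. 5.9; Piatetski-Shapiro (1979);
Cogdell (2004), Thm. 1.1) through the reduction `Shalika1974_fourierExpansion_cuspForm_of_summable`
of `CuspFormFourierExpansionGLn`: `Shalika1974_fourierExpansion_cuspForm_holds`.

Proof of the summability (Jacquet–Piatetski-Shapiro–Shalika's majorant, organised as follows).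
For a coset `c` put `g_c = diag(γ_c, 1) x = u_c h_c` (Iwasawa, `exists_adelicUnipotent_mul_iwasawa`:
`h_{c,∞} = diag(d_c) κ_c`, `h_{c,f} = diag(t_c) k_c`), reduce `u_c` modulo `N_n(K)` into Tate's box
(`existsUnique_smul_mem_unipotentTateDomain`): `Ω_c = γ^N_c u_c`, and let `Γ_c = γ^K_c diag(γ_c, 1) ∈ GL_n(K)`,
so that `Γ_c x = Ω_c h_c`. The rows `ξ_{c,i}` (`i < n-1`) of `Γ_c` are non-zero rational vectors,
the map `c ↦ (ξ_{c,i})_i` is injective, and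

* `‖(ξ_{c,i} x)_∞‖ ≤ n B R_c` with `R_c = max_l ‖d_{c,l}‖` (`B` the box bound);
* `‖W_φ(g_c)‖ R_c^{M} ≤ C₁` (uniform archimedean decay on the determinant slice of `x`,
  `IsCuspFormGL.exists_norm_whittakerDepth_zero_mul_pow_le`, the last row of `h_c` being that of `x`);
* if `W_φ(g_c) ≠ 0` then `(ξ_{c,i} x)_f` lies in a fixed compact set (the finite support of `W_φ`,
  `valued_lt_of_whittakerDepth_zero_ne_zero`, and Tate's bound `exists_finset_bound_adeleAddCharAt`).

Hence `‖W_φ(g_c)‖ ≤ C₀ ∏_{i<n-1} ‖(ξ_{c,i} x)_∞‖^{-θ}` with `θ > n[K:ℚ]`, and the lattice sums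
`∑_ξ ‖(ξ x)_∞‖^{-θ}` converge (`tsum_norm_vecInfinitePart_rpow_neg_lt_top`); the comparison is
`summable_of_le_mul_prod_of_injOn`.

## References

* J. A. Shalika, *The multiplicity one theorem for GL_n*, Ann. of Math. 100 (1974), Thm. 5.9
  [Shalika1974].
* J. W. Cogdell, *Analytic theory of L-functions for GL_n*, in: An introduction to the Langlands
  program (2004), Thm. 1.1 [CogdellAnalyticTheory2004].
* H. Jacquet, I. I. Piatetski-Shapiro, J. Shalika, *Automorphic forms on GL(3)*, Ann. of Math. 109
  (1979) (the gauge estimates for Whittaker functions).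
-/

noncomputable section

open MeasureTheory NumberField NumberField.mixedEmbedding NumberField.InfinitePlace IsDedekindDomain Matrix Set
  Filter Topology
open scoped MatrixGroups Classical NNReal ENNReal

namespace Literature.NumberTheory.Automorphic

/-! ### Matrix bookkeeping -/

section Matrices

variable {m : ℕ} {R : Type*} [CommRing R]

/-- The last row of `U M` is the last row of `M` for `U` upper unitriangular. [folklore] -/
theorem mul_apply_last_of_mem_upperUnitriangular {U : GL (Fin (m + 1)) R} (hU : U ∈ upperUnitriangular (Fin (m + 1)) R)
    (M : Matrix (Fin (m + 1)) (Fin (m + 1)) R) (j : Fin (m + 1)) :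
    ((U : Matrix (Fin (m + 1)) (Fin (m + 1)) R) * M) (Fin.last m) j = M (Fin.last m) j := by
  rw [mem_upperUnitriangular_iff] at hU
  rw [Matrix.mul_apply, Finset.sum_eq_single (Fin.last m)]
  · rw [hU.2, one_mul]
  · intro l _ hl
    rw [show (U : Matrix (Fin (m + 1)) (Fin (m + 1)) R) (Fin.last m) l = 0 from hU.1 (lt_of_le_of_ne (Fin.le_last l) hl),
      zero_mul]
  · intro h; exact absurd (Finset.mem_univ _) h

/-- The last row of `diag(g, 1) M` is the last row of `M`. [folklore] -/
theorem glCorner_mul_apply_last (g : GL (Fin m) R) (M : Matrix (Fin (m + 1)) (Fin (m + 1)) R) (j : Fin (m + 1)) :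
    (((glCorner R (Nat.le_succ m) g : GL (Fin (m + 1)) R) : Matrix (Fin (m + 1)) (Fin (m + 1)) R) * M) (Fin.last m) j =
      M (Fin.last m) j := by
  have hrow : ∀ l : Fin (m + 1), ((glCorner R (Nat.le_succ m) g : GL (Fin (m + 1)) R) : Matrix (Fin (m + 1)) (Fin (m + 1)) R)
      (Fin.last m) l = if Fin.last m = l then 1 else 0 := by
    intro l
    rw [glCorner_apply_val, dif_neg (by simp)]
    by_cases hl : (l : ℕ) < m
    · rw [if_pos hl, if_neg]
      intro h; rw [← h] at hl; simp at hl
    · rw [if_neg hl]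
  rw [Matrix.mul_apply, Finset.sum_eq_single (Fin.last m)]
  · rw [hrow, if_pos rfl, one_mul]
  · intro l _ hl
    rw [hrow, if_neg (Ne.symm hl), zero_mul]
  · intro h; exact absurd (Finset.mem_univ _) h

/-- The last row of `γ diag(g, 1)` for `γ` unitriangular is `(0, …, 0, 1)`. [folklore] -/
theorem mul_glCorner_apply_last {γ : GL (Fin (m + 1)) R} (hγ : γ ∈ upperUnitriangular (Fin (m + 1)) R) (g : GL (Fin m) R)
    (j : Fin (m + 1)) :
    ((γ * glCorner R (Nat.le_succ m) g : GL (Fin (m + 1)) R) : Matrix (Fin (m + 1)) (Fin (m + 1)) R) (Fin.last m) j =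
      if Fin.last m = j then 1 else 0 := by
  rw [Units.val_mul, mul_apply_last_of_mem_upperUnitriangular hγ, ← Matrix.mul_one
    ((glCorner R (Nat.le_succ m) g : GL (Fin (m + 1)) R) : Matrix (Fin (m + 1)) (Fin (m + 1)) R), glCorner_mul_apply_last,
    Matrix.one_apply]

end Matrices

/-! ### Cosets and representatives -/

section Cosets

variable {m : ℕ} {K : Type} [Field K]

/-- **Injectivity of the representatives**: if `γ diag(γ_c, 1) = γ' diag(γ_{c'}, 1)` with
`γ, γ' ∈ N_{m+1}(K)` then the cosets `c = N_m(K) γ_c` and `c' = N_m(K) γ_{c'}` agree. [folklore] -/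
theorem quotient_eq_of_mul_glCorner_out_eq {c c' : Quotient (QuotientGroup.rightRel (upperUnitriangular (Fin m) K))}
    {γ γ' : GL (Fin (m + 1)) K} (hγ : γ ∈ upperUnitriangular (Fin (m + 1)) K) (hγ' : γ' ∈ upperUnitriangular (Fin (m + 1)) K)
    (h : γ * glCorner K (Nat.le_succ m) c.out = γ' * glCorner K (Nat.le_succ m) c'.out) : c = c' := by
  have h1 : glCorner K (Nat.le_succ m) (c'.out * c.out⁻¹) = γ'⁻¹ * γ := by
    rw [map_mul, map_inv, eq_inv_mul_iff_mul_eq, ← mul_assoc, ← h, mul_assoc, mul_inv_cancel, mul_one]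
  have h2 : c'.out * c.out⁻¹ ∈ upperUnitriangular (Fin m) K := by
    rw [← glCorner_mem_upperUnitriangular_iff, h1]
    exact (upperUnitriangular (Fin (m + 1)) K).mul_mem (inv_mem hγ') hγ
  rw [← Quotient.out_eq c, ← Quotient.out_eq c']
  exact Quotient.sound (QuotientGroup.rightRel_apply.2 h2)

/-- Rows of an invertible matrix are non-zero. [folklore] -/
theorem row_ne_zero {n : ℕ} (Γ : GL (Fin n) K) (i : Fin n) : (fun j => (Γ : Matrix (Fin n) (Fin n) K) i j) ≠ 0 := by
  intro h
  have hdet : (Γ : Matrix (Fin n) (Fin n) K).det = 0 := Matrix.det_eq_zero_of_row_eq_zero i fun j => congrFun h j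
  have hu : IsUnit (Γ : Matrix (Fin n) (Fin n) K).det := (Matrix.isUnit_iff_isUnit_det _).1 (Units.isUnit Γ)
  rw [hdet] at hu
  exact not_isUnit_zero hu

end Cosets

/-! ### Denominators of finitely many finite adeles -/

section Denominators

variable (K : Type) [Field K] [NumberField K]

/-- A finite family of finite adeles has a common denominator `e₀ ∈ 𝓞_K ∖ {0}`:
`|a_{i,v}| · |e₀|_v ≤ 1` for all `i, v`. [folklore] -/
theorem exists_ne_zero_forall_valued_mul_intValuation_le {ι : Type*} [Finite ι] (a : ι → FiniteAdeleRing (𝓞 K) K) :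
    ∃ e₀ : 𝓞 K, e₀ ≠ 0 ∧ ∀ (i : ι) (v : HeightOneSpectrum (𝓞 K)), Valued.v (a i v) * v.intValuation e₀ ≤ 1 := by
  haveI := Fintype.ofFinite ι
  choose d hd0 hd using fun i => FiniteAdeleRing.exists_ne_zero_forall_mul_mem (𝓞 K) K (a i)
  refine ⟨∏ i, d i, Finset.prod_ne_zero_iff.2 fun i _ => hd0 i, fun i v => ?_⟩
  have h1 : Valued.v (a i v) * v.intValuation (d i) ≤ 1 := by
    have h := (HeightOneSpectrum.mem_adicCompletionIntegers (𝓞 K) K v).1 (hd i v)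
    rw [FiniteAdeleRing.mul_apply', FiniteAdeleRing.algebraMap_int_apply, map_mul, valued_algebraMap_adicCompletion,
      mul_comm] at h
    exact h
  rw [map_prod, ← Finset.mul_prod_erase _ _ (Finset.mem_univ i), ← mul_assoc]
  exact mul_le_of_le_of_le_one h1 (Finset.prod_le_one' fun j _ => v.intValuation_le_one (d j))

/-- Integrality test for `e · y` at `v`: `|y_v| · |e|_v ≤ 1`. [folklore] -/
theorem mul_apply_mem_adicCompletionIntegers_of_le {e : 𝓞 K} {y : FiniteAdeleRing (𝓞 K) K} {v : HeightOneSpectrum (𝓞 K)}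
    (h : Valued.v (y v) * v.intValuation e ≤ 1) :
    (algebraMap (𝓞 K) (FiniteAdeleRing (𝓞 K) K) e * y) v ∈ v.adicCompletionIntegers K := by
  have h1 : (algebraMap (𝓞 K) (FiniteAdeleRing (𝓞 K) K) e * y) v = algebraMap (𝓞 K) (v.adicCompletion K) e * y v := by
    rw [FiniteAdeleRing.mul_apply']
    exact congrArg (· * y v) (FiniteAdeleRing.algebraMap_int_apply (R := 𝓞 K) (K := K) e v)
  have h2 : Valued.v (algebraMap (𝓞 K) (v.adicCompletion K) e) = v.intValuation e :=
    valued_algebraMap_adicCompletion (R := 𝓞 K) (K := K) v e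
  rw [HeightOneSpectrum.mem_adicCompletionIntegers, h1, map_mul, h2, mul_comm]
  exact h

end Denominators

/-! ### The majorant -/

section Majorant

variable {m : ℕ} {K : Type} [Field K] [NumberField K]
variable [MeasurableSpace (GL (Fin (m + 1)) (AdeleRing (𝓞 K) K))] [BorelSpace (GL (Fin (m + 1)) (AdeleRing (𝓞 K) K))]

/-- **The Whittaker series of `φ` is absolutely summable** (core statement). Hypotheses: `φ` is left
`GL_n(K)`-invariant, right invariant under a principal congruence level `K(𝔫)`, `𝔫 ≠ 0`, and its
Whittaker transform `W_φ = whittakerDepth 0 φ` obeys the uniform archimedean decay on the determinant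
slice of `x` (`‖W_φ(g)‖ r_l^M ≤ C r_{n-1}^M` in Iwasawa coordinates). Conclusion:
`∑_{γ ∈ N_{n-1}(K)\GL_{n-1}(K)} ‖W_φ(diag(γ,1) x)‖ < ∞` (`n = m + 1`). See the module docstring for
the proof. [cite: CogdellAnalyticTheory2004, Thm. 1.1] -/
theorem summable_norm_whittakerDepth_glCorner_of_decay {φ : GL (Fin (m + 1)) (AdeleRing (𝓞 K) K) → ℂ}
    (hφK : ∀ (γ₀ : GL (Fin (m + 1)) K) (y : GL (Fin (m + 1)) (AdeleRing (𝓞 K) K)), φ (ratGL K γ₀ * y) = φ y)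
    {𝔫 : Ideal (𝓞 K)} (h𝔫 : 𝔫 ≠ 0) (hφU : ∀ y, ∀ u ∈ principalCongruenceLevel (m + 1) K 𝔫, φ (y * u) = φ y)
    (x : GL (Fin (m + 1)) (AdeleRing (𝓞 K) K))
    (hdecay : ∀ (w : InfinitePlace K) (M : ℕ) (l : Fin (m + 1)), ∃ C : ℝ, 0 ≤ C ∧
      ∀ (g : GL (Fin (m + 1)) (AdeleRing (𝓞 K) K)) (dd : Fin (m + 1) → (mixedSpace K)ˣ) (r : Fin (m + 1) → ℝ)
        (κ : GL (Fin (m + 1)) (mixedSpace K)), (∀ i, 0 < r i) →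
        (∀ i, mixedSpaceEvalAt K w (dd i : mixedSpace K) = (r i : ℂ)) → κ ∈ Kinf (m + 1) K →
        GLn.toMixed (m + 1) K g = glDiagonal (m + 1) (mixedSpace K) dd * κ →
        detNormUnit (m + 1) K g = detNormUnit (m + 1) K x →
        ‖whittakerDepth 0 φ g‖ * r l ^ M ≤ C * r (Fin.last m) ^ M) :
    Summable fun γ : Quotient (QuotientGroup.rightRel (upperUnitriangular (Fin m) K)) =>
      ‖whittakerDepth 0 φ (glCorner (AdeleRing (𝓞 K) K) (Nat.le_succ m) (ratGL K γ.out) * x)‖ := by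
  -- ### notation
  set A := AdeleRing (𝓞 K) K with hA
  set n : ℕ := m + 1 with hn
  set W : GL (Fin (m + 1)) A → ℂ := whittakerDepth 0 φ with hW
  set gq : Quotient (QuotientGroup.rightRel (upperUnitriangular (Fin m) K)) → GL (Fin (m + 1)) A :=
    fun c => glCorner A (Nat.le_succ m) (ratGL K c.out) * x with hgq
  have hφK' : ∀ (γ₀ : GL (Fin (m + 1)) K) (y : GL (Fin (m + 1)) A),
      φ (Matrix.GeneralLinearGroup.map (algebraMap K A) γ₀ * y) = φ y := hφK
  -- ### constants
  -- Tate's box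
  obtain ⟨B, hB1, hB⟩ := exists_forall_norm_le_of_mem_adeleFundamentalDomain K
  have hB0 : 0 ≤ B := zero_le_one.trans hB1
  -- Tate's character bound at the level `𝔫`
  obtain ⟨S, Bv, hBv1, hBvS, hBv⟩ := exists_finset_bound_adeleAddCharAt K h𝔫
  have hBv0 : ∀ v, Bv v ≠ 0 := fun v => ne_of_gt (lt_of_lt_of_le zero_lt_one (hBv1 v))
  -- denominators: the last row of `x`, and the bad places
  obtain ⟨e₀, he₀0, he₀⟩ := exists_ne_zero_forall_valued_mul_intValuation_le K
    (fun j : Fin (m + 1) => (((x : Matrix (Fin (m + 1)) (Fin (m + 1)) A) (Fin.last m) j).2))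
  obtain ⟨e₁, he₁0, he₁⟩ := exists_ne_zero_forall_valuation_le K S (β := fun v => ((Bv v) ^ (m + 1))⁻¹)
    (fun v => inv_ne_zero (pow_ne_zero _ (hBv0 v)))
  have he₁' : ∀ v, (Bv v) ^ (m + 1) * v.intValuation e₁ ≤ 1 := by
    intro v
    by_cases hv : v ∈ S
    · have h := he₁ v hv
      rw [HeightOneSpectrum.valuation_of_algebraMap] at h
      calc (Bv v) ^ (m + 1) * v.intValuation e₁ ≤ (Bv v) ^ (m + 1) * ((Bv v) ^ (m + 1))⁻¹ := mul_le_mul' le_rfl h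
        _ = 1 := mul_inv_cancel₀ (pow_ne_zero _ (hBv0 v))
    · rw [hBvS v hv, one_pow, one_mul]
      exact v.intValuation_le_one e₁
  set e : 𝓞 K := e₀ * e₁ with he
  have he0 : e ≠ 0 := mul_ne_zero he₀0 he₁0
  obtain ⟨Sf, hSfc, hSf⟩ := exists_isCompact_forall_denominator_mem (K := K) (ι := Fin (m + 1)) he0
  -- the lattice sums
  set M₀ : ℕ := (m + 1) * Module.finrank ℚ K + 1 with hM₀
  have hθ : ((m + 1 : ℕ) : ℝ) * Module.finrank ℚ K < (M₀ : ℝ) := by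
    rw [hM₀]; push_cast; linarith
  set Λ : Set (Fin (m + 1) → K) := {v | v ≠ 0 ∧ vecFinitePart K (m + 1) (ratVec K v ᵥ* (x : Matrix (Fin (m + 1)) (Fin (m + 1)) A)) ∈ Sf}
    with hΛ
  set wt : (Fin (m + 1) → K) → ℝ≥0∞ := fun v =>
    ENNReal.ofReal (‖vecInfinitePart K (m + 1) (ratVec K v ᵥ* (x : Matrix (Fin (m + 1)) (Fin (m + 1)) A))‖ ^ (-(M₀ : ℝ))) with hwt
  have hwt : ∑' v : Λ, wt v ≠ ⊤ := ne_of_lt (tsum_norm_vecInfinitePart_rpow_neg_lt_top K x hSfc hθ)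
  -- the decay constants
  choose Cd hCd0 hCd using fun (w : InfinitePlace K) (l : Fin (m + 1)) => hdecay w (m * M₀) l
  set C₁ : ℝ := ∑ w, ∑ l, Cd w l with hC₁
  have hC₁0 : 0 ≤ C₁ := Finset.sum_nonneg fun w _ => Finset.sum_nonneg fun l _ => hCd0 w l
  have hCdle : ∀ w l, Cd w l ≤ C₁ := fun w l =>
    (Finset.single_le_sum (f := fun l' => Cd w l') (fun l' _ => hCd0 w l') (Finset.mem_univ l)).trans
      (Finset.single_le_sum (f := fun w' => ∑ l', Cd w' l') (fun w' _ => Finset.sum_nonneg fun l' _ => hCd0 w' l') (Finset.mem_univ w))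
  -- the last row of `x` at infinity
  set cx : ℝ := (m + 1 : ℕ) * ∑ j, ‖(GLn.toMixed (m + 1) K x : Matrix (Fin (m + 1)) (Fin (m + 1)) (mixedSpace K)) (Fin.last m) j‖ with hcx
  have hcx0 : 0 ≤ cx := by positivity
  -- ### per-coset data
  choose u h ρ hρ κ t k hu hgh hκ htm hk hsn using fun c : Quotient (QuotientGroup.rightRel (upperUnitriangular (Fin m) K)) =>
    exists_adelicUnipotent_mul_iwasawa (gq c)
  set dd : Quotient (QuotientGroup.rightRel (upperUnitriangular (Fin m) K)) → Fin (m + 1) → (mixedSpace K)ˣ :=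
    fun c i => mixedPosUnit K (fun w => ρ c w i) (fun w => hρ c w i) with hdd
  have htm' : ∀ c, GLn.toMixed (m + 1) K (h c) = glDiagonal (m + 1) (mixedSpace K) (dd c) * κ c := htm
  have hdd : ∀ c w i, mixedSpaceEvalAt K w (dd c i : mixedSpace K) = (ρ c w i : ℂ) := fun c w i =>
    mixedSpaceEvalAt_mixedPosUnit _ _ w
  choose γN hγN using fun c : Quotient (QuotientGroup.rightRel (upperUnitriangular (Fin m) K)) =>
    (existsUnique_smul_mem_unipotentTateDomain (n := m + 1) (K := K) ⟨u c, hu c⟩).exists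
  choose γK hγK using fun c : Quotient (QuotientGroup.rightRel (upperUnitriangular (Fin m) K)) =>
    (mem_rationalUnipotent_iff _).1 (γN c).2
  have hγKu : ∀ c, γK c ∈ upperUnitriangular (Fin (m + 1)) K := fun c => mem_upperUnitriangular_of_map_eq (hγK c)
  set Ωu : Quotient (QuotientGroup.rightRel (upperUnitriangular (Fin m) K)) → ↥(adelicUnipotent (m + 1) K) :=
    fun c => γN c • ⟨u c, hu c⟩ with hΩu
  have hΩT : ∀ c, Ωu c ∈ unipotentTateDomain (m + 1) K := hγN
  have hΩval : ∀ c, ((Ωu c : ↥(adelicUnipotent (m + 1) K)) : GL (Fin (m + 1)) A) =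
      ((γN c : ↥(adelicUnipotent (m + 1) K)) : GL (Fin (m + 1)) A) * u c := fun c => rfl
  set Γ : Quotient (QuotientGroup.rightRel (upperUnitriangular (Fin m) K)) → GL (Fin (m + 1)) K :=
    fun c => γK c * glCorner K (Nat.le_succ m) c.out with hΓ
  set F : Quotient (QuotientGroup.rightRel (upperUnitriangular (Fin m) K)) → Fin m → (Fin (m + 1) → K) :=
    fun c i j => (Γ c : Matrix (Fin (m + 1)) (Fin (m + 1)) K) (Fin.castSucc i) j with hF
  -- ### identities
  -- `Γ_c x = Ω_c h_c`
  have hΓx : ∀ c, ratGL K (Γ c) * x = ((Ωu c : ↥(adelicUnipotent (m + 1) K)) : GL (Fin (m + 1)) A) * h c := by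
    intro c
    have e1 : ratGL K (Γ c) = ratGL K (γK c) * ratGL K (glCorner K (Nat.le_succ m) c.out) := map_mul _ _ _
    rw [e1, hΩval, mul_assoc, mul_assoc, ← hgh c, ratGL_glCorner]
    exact congrArg (· * (glCorner A (Nat.le_succ m) (ratGL K c.out) * x)) (hγK c)
  -- `‖W(g_c)‖ = ‖W(h_c)‖`
  have hucol : ∀ c, u c ∈ adelicColRange (m + 1) K (0 + 1) (m + 1 - 1) := by
    intro c
    show u c ∈ unipotentColRange (m + 1) A (0 + 1) (m + 1 - 1)
    rw [zero_add, unipotentColRange_one_eq_upperUnitriangular]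
    exact hu c
  have hWgh : ∀ c, ‖W (gq c)‖ = ‖W (h c)‖ := by
    intro c
    rw [hW, hgh c]
    exact norm_whittakerDepth_colRange_mul hφK' (Nat.succ_pos m) (hucol c) (h c)
  -- `|det h_c| = |det x|`
  have hdet : ∀ c, detNormUnit (m + 1) K (h c) = detNormUnit (m + 1) K x := by
    intro c
    have e1 : h c = (u c)⁻¹ * gq c := by rw [hgh c, inv_mul_cancel_left]
    have e2 : detNormUnit (m + 1) K (glCorner A (Nat.le_succ m) (ratGL K c.out)) = 1 := by
      rw [← ratGL_glCorner]
      exact detNormUnit_eq_one_of_mem_arithmeticSubgroup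
        (show _ ∈ rationalPointsGL (m + 1) K from ⟨glCorner K (Nat.le_succ m) c.out, rfl⟩)
    rw [e1, map_mul, detNormUnit_eq_one_of_mem_upperUnitriangular (inv_mem (hu c)), one_mul, hgq]
    simp only
    rw [map_mul, e2, one_mul]
  -- the last row of `h_c` is the last row of `x`
  have hlast : ∀ c j, ((h c : GL (Fin (m + 1)) A) : Matrix (Fin (m + 1)) (Fin (m + 1)) A) (Fin.last m) j =
      (x : Matrix (Fin (m + 1)) (Fin (m + 1)) A) (Fin.last m) j := by
    intro c j
    have e1 : h c = (u c)⁻¹ * gq c := by rw [hgh c, inv_mul_cancel_left]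
    rw [e1, Units.val_mul, mul_apply_last_of_mem_upperUnitriangular (inv_mem (hu c)), hgq]
    simp only
    rw [Units.val_mul, glCorner_mul_apply_last]
  -- `ρ_{c,w}(last) ≤ cx`
  have hρlast : ∀ c w, ρ c w (Fin.last m) ≤ cx := by
    intro c w
    obtain ⟨j, hj⟩ := exists_le_mul_norm_entry_of_toMixed_eq (hκ c) (htm' c) w (Fin.last m) (hρ c w _).le (hdd c w _)
    rw [hlast c j] at hj
    refine hj.trans (mul_le_mul_of_nonneg_left ?_ (Nat.cast_nonneg _))
    rw [← GLn.coe_toMixed_apply']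
    exact Finset.single_le_sum (f := fun j' => ‖(GLn.toMixed (m + 1) K x : Matrix (Fin (m + 1)) (Fin (m + 1)) (mixedSpace K))
      (Fin.last m) j'‖) (fun _ _ => norm_nonneg _) (Finset.mem_univ j)
  -- the size `R_c` of the torus part
  set Rf : Quotient (QuotientGroup.rightRel (upperUnitriangular (Fin m) K)) → ℝ :=
    fun c => Finset.univ.sup' ⟨Fin.last m, Finset.mem_univ _⟩ fun l => ‖((dd c l : (mixedSpace K)ˣ) : mixedSpace K)‖ with hRf
  have hRle : ∀ c l, ‖((dd c l : (mixedSpace K)ˣ) : mixedSpace K)‖ ≤ Rf c := fun c l =>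
    Finset.le_sup' (fun l => ‖((dd c l : (mixedSpace K)ˣ) : mixedSpace K)‖) (Finset.mem_univ l)
  have hnormρ : ∀ c w l, ‖mixedSpaceEvalAt K w ((dd c l : (mixedSpace K)ˣ) : mixedSpace K)‖ = ρ c w l := by
    intro c w l
    rw [hdd, Complex.norm_real, Real.norm_of_nonneg (hρ c w l).le]
  have hRpos : ∀ c, 0 < Rf c := by
    intro c
    obtain ⟨w⟩ : Nonempty (InfinitePlace K) := inferInstance
    calc (0 : ℝ) < ρ c w (Fin.last m) := hρ c w _
      _ = ‖mixedSpaceEvalAt K w ((dd c (Fin.last m) : (mixedSpace K)ˣ) : mixedSpace K)‖ := (hnormρ c w _).symm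
      _ ≤ ‖((dd c (Fin.last m) : (mixedSpace K)ˣ) : mixedSpace K)‖ := norm_mixedSpaceEvalAt_le w _
      _ ≤ Rf c := hRle c _
  have hRex : ∀ c, ∃ w l, Rf c ≤ ρ c w l := by
    intro c
    obtain ⟨l, -, hl⟩ := Finset.exists_mem_eq_sup' (⟨Fin.last m, Finset.mem_univ _⟩ : (Finset.univ : Finset (Fin (m + 1))).Nonempty)
      fun l => ‖((dd c l : (mixedSpace K)ˣ) : mixedSpace K)‖
    obtain ⟨w, hw⟩ := exists_norm_le_norm_mixedSpaceEvalAt (K := K) ((dd c l : (mixedSpace K)ˣ) : mixedSpace K)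
    refine ⟨w, l, ?_⟩
    rw [hRf]
    simp only
    rw [hl, ← hnormρ c w l]
    exact hw
  -- ### the decay estimate: `‖W(h_c)‖ R_c^{m M₀} ≤ C₁ cx^{m M₀}`
  have hkey : ∀ c, ‖W (h c)‖ * Rf c ^ (m * M₀) ≤ C₁ * cx ^ (m * M₀) := by
    intro c
    obtain ⟨w, l, hwl⟩ := hRex c
    have h1 := hCd w l (h c) (dd c) (ρ c w) (κ c) (hρ c w) (hdd c w) (hκ c) (htm' c) (hdet c)
    have hW0 : 0 ≤ ‖W (h c)‖ := norm_nonneg _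
    calc ‖W (h c)‖ * Rf c ^ (m * M₀) ≤ ‖W (h c)‖ * ρ c w l ^ (m * M₀) :=
          mul_le_mul_of_nonneg_left (pow_le_pow_left₀ (hRpos c).le hwl _) hW0
      _ ≤ Cd w l * ρ c w (Fin.last m) ^ (m * M₀) := h1
      _ ≤ C₁ * cx ^ (m * M₀) :=
          mul_le_mul (hCdle w l) (pow_le_pow_left₀ (hρ c w _).le (hρlast c w) _) (pow_nonneg (hρ c w _).le _) hC₁0
  -- ### the rows of `Γ_c x = Ω_c h_c`
  have hrow : ∀ c (i : Fin m) (j : Fin (m + 1)),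
      (ratVec K (F c i) ᵥ* (x : Matrix (Fin (m + 1)) (Fin (m + 1)) A)) j =
        (((((Ωu c : ↥(adelicUnipotent (m + 1) K)) : GL (Fin (m + 1)) A) * h c : GL (Fin (m + 1)) A)) :
          Matrix (Fin (m + 1)) (Fin (m + 1)) A) (Fin.castSucc i) j := by
    intro c i j
    rw [← hΓx c, Units.val_mul, Matrix.mul_apply]
    change ∑ l, ratVec K (F c i) l * (x : Matrix (Fin (m + 1)) (Fin (m + 1)) A) l j = _
    refine Finset.sum_congr rfl fun l _ => ?_
    rw [ratGL_apply]
    rfl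
  -- entries of `Ω_c` lie in the box
  have hΩbox : ∀ c i l, ((((Ωu c : ↥(adelicUnipotent (m + 1) K)) : GL (Fin (m + 1)) A)) : Matrix (Fin (m + 1)) (Fin (m + 1)) A) i l ∈
      adeleFundamentalDomain K ∨
      ((((Ωu c : ↥(adelicUnipotent (m + 1) K)) : GL (Fin (m + 1)) A)) : Matrix (Fin (m + 1)) (Fin (m + 1)) A) i l = 0 ∨
      ((((Ωu c : ↥(adelicUnipotent (m + 1) K)) : GL (Fin (m + 1)) A)) : Matrix (Fin (m + 1)) (Fin (m + 1)) A) i l = 1 := by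
    intro c i l
    rcases lt_trichotomy i l with hil | rfl | hli
    · exact Or.inl ((mem_unipotentTateDomain_iff.1 (hΩT c)) i l hil)
    · exact Or.inr (Or.inr (((mem_upperUnitriangular_iff _).1 (Ωu c).2).2 i))
    · exact Or.inr (Or.inl (((mem_upperUnitriangular_iff _).1 (Ωu c).2).1 hli))
  -- archimedean size of the rows
  have hNle : ∀ c (i : Fin m), ‖vecInfinitePart K (m + 1) (ratVec K (F c i) ᵥ* (x : Matrix (Fin (m + 1)) (Fin (m + 1)) A))‖ ≤
      (m + 1 : ℕ) * B * Rf c := by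
    intro c i
    have h0 : 0 ≤ ((m + 1 : ℕ) : ℝ) * B * Rf c := by have := (hRpos c).le; positivity
    refine (pi_norm_le_iff_of_nonneg h0).2 fun j => ?_
    rw [vecInfinitePart_apply, hrow c i j]
    have h := norm_entry_mul_le (n := m + 1) (K := K) (Ω := ((Ωu c : ↥(adelicUnipotent (m + 1) K)) : GL (Fin (m + 1)) A)) (h := h c)
      (B := B) (R := Rf c) (fun i' l => (hB _ (hΩbox c i' l)).1)
      (fun l j' => (norm_entry_le_of_toMixed_eq (hκ c) (htm' c) l j').trans (hRle c l)) (Fin.castSucc i) j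
    simpa only [Fintype.card_fin] using h
  -- ### finite support: `|t_{c,l}|_v |e|_v ≤ 1` when `W(h_c) ≠ 0`
  have htl : ∀ c, W (h c) ≠ 0 → ∀ (v : HeightOneSpectrum (𝓞 K)) (l : Fin (m + 1)),
      Valued.v (((t c l : (FiniteAdeleRing (𝓞 K) K)ˣ) : FiniteAdeleRing (𝓞 K) K) v) * v.intValuation e ≤ 1 := by
    intro c hWc v
    -- one step of the chain
    have hstep : ∀ (l : Fin (m + 1)) (hl : (l : ℕ) + 1 < m + 1),
        Valued.v (((t c l : (FiniteAdeleRing (𝓞 K) K)ˣ) : FiniteAdeleRing (𝓞 K) K) v) ≤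
          Bv v * Valued.v (((t c ⟨(l : ℕ) + 1, hl⟩ : (FiniteAdeleRing (𝓞 K) K)ˣ) : FiniteAdeleRing (𝓞 K) K) v) := by
      intro l hl
      refine hBv v _ _ fun y hy => ?_
      have h := valued_lt_of_whittakerDepth_zero_ne_zero hφK' hφU (hk c) (hsn c) hWc v hl hy
      have el : (⟨(l : ℕ), by omega⟩ : Fin (m + 1)) = l := Fin.ext rfl
      rw [el] at h
      exact h
    -- the chain down to the last row
    have hchain : ∀ (d : ℕ) (l : Fin (m + 1)), (l : ℕ) + d = m →
        Valued.v (((t c l : (FiniteAdeleRing (𝓞 K) K)ˣ) : FiniteAdeleRing (𝓞 K) K) v) ≤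
          Bv v ^ d * Valued.v (((t c (Fin.last m) : (FiniteAdeleRing (𝓞 K) K)ˣ) : FiniteAdeleRing (𝓞 K) K) v) := by
      intro d
      induction d with
      | zero =>
        intro l hl
        have el : l = Fin.last m := Fin.ext (by simpa using hl)
        rw [pow_zero, one_mul, el]
      | succ d ih =>
        intro l hl
        have hl1 : (l : ℕ) + 1 < m + 1 := by omega
        have h1 := hstep l hl1
        have h2 := ih ⟨(l : ℕ) + 1, hl1⟩ (by simp only; omega)
        calc Valued.v (((t c l : (FiniteAdeleRing (𝓞 K) K)ˣ) : FiniteAdeleRing (𝓞 K) K) v)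
            ≤ Bv v * Valued.v (((t c ⟨(l : ℕ) + 1, hl1⟩ : (FiniteAdeleRing (𝓞 K) K)ˣ) : FiniteAdeleRing (𝓞 K) K) v) := h1
          _ ≤ Bv v * (Bv v ^ d * Valued.v (((t c (Fin.last m) : (FiniteAdeleRing (𝓞 K) K)ˣ) : FiniteAdeleRing (𝓞 K) K) v)) :=
              mul_le_mul' le_rfl h2
          _ = Bv v ^ (d + 1) * Valued.v (((t c (Fin.last m) : (FiniteAdeleRing (𝓞 K) K)ˣ) : FiniteAdeleRing (𝓞 K) K) v) := by
              rw [pow_succ, ← mul_assoc, mul_comm (Bv v)]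
    -- the last row
    obtain ⟨j₀, hj₀⟩ := exists_valued_le_valued_entry_of_sndHom_eq (hk c) (hsn c) v (Fin.last m)
    rw [hlast c j₀] at hj₀
    intro l
    have hc := hchain (m - l) l (by omega)
    have hpow : Bv v ^ (m - (l : ℕ)) ≤ Bv v ^ (m + 1) := pow_le_pow_right' (hBv1 v) (by omega)
    rw [he, map_mul]
    calc Valued.v (((t c l : (FiniteAdeleRing (𝓞 K) K)ˣ) : FiniteAdeleRing (𝓞 K) K) v) * (v.intValuation e₀ * v.intValuation e₁)
        ≤ (Bv v ^ (m + 1) * Valued.v (((t c (Fin.last m) : (FiniteAdeleRing (𝓞 K) K)ˣ) : FiniteAdeleRing (𝓞 K) K) v)) *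
            (v.intValuation e₀ * v.intValuation e₁) :=
          mul_le_mul' (hc.trans (mul_le_mul' hpow le_rfl)) le_rfl
      _ = (Bv v ^ (m + 1) * v.intValuation e₁) *
            (Valued.v (((t c (Fin.last m) : (FiniteAdeleRing (𝓞 K) K)ˣ) : FiniteAdeleRing (𝓞 K) K) v) * v.intValuation e₀) := by
          simp only [mul_assoc, mul_comm, mul_left_comm]
      _ ≤ 1 * 1 := mul_le_mul' (he₁' v) ((mul_le_mul' hj₀ le_rfl).trans (he₀ j₀ v))
      _ = 1 := one_mul 1
  -- the finite components of the rows lie in the compact set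
  have hmemSf : ∀ c, W (h c) ≠ 0 → ∀ i : Fin m,
      vecFinitePart K (m + 1) (ratVec K (F c i) ᵥ* (x : Matrix (Fin (m + 1)) (Fin (m + 1)) A)) ∈ Sf := by
    intro c hWc i
    refine hSf _ fun j v => mul_apply_mem_adicCompletionIntegers_of_le K ?_
    rw [vecFinitePart_apply, hrow c i j]
    refine valued_entry_mul_mul_le_one v (fun i' l =>
      (HeightOneSpectrum.mem_adicCompletionIntegers (𝓞 K) K v).1 ((hB _ (hΩbox c i' l)).2 v)) (fun l j' => ?_) (Fin.castSucc i) j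
    exact (mul_le_mul' (valued_entry_le_of_sndHom_eq (hk c) (hsn c) v l j') le_rfl).trans (htl c hWc v l)
  -- ### injectivity of `c ↦ (ξ_{c,i})_i`
  have hinj : Function.Injective F := by
    intro c c' hcc'
    have hΓeq : Γ c = Γ c' := by
      refine Units.ext (Matrix.ext fun i j => ?_)
      rcases Fin.eq_castSucc_or_eq_last i with ⟨i', rfl⟩ | rfl
      · exact congrFun (congrFun hcc' i') j
      · rw [hΓ]
        simp only
        rw [mul_glCorner_apply_last (hγKu c), mul_glCorner_apply_last (hγKu c')]
    exact quotient_eq_of_mul_glCorner_out_eq (hγKu c) (hγKu c') hΓeq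
  -- ### the comparison
  set C₀ : ℝ := (((m + 1 : ℕ) : ℝ) * B) ^ (m * M₀) * (C₁ * cx ^ (m * M₀)) with hC₀
  have hC₀0 : 0 ≤ C₀ := by positivity
  refine summable_of_le_mul_prod_of_injOn (a := fun c => ‖W (gq c)‖) (fun c => norm_nonneg _) (S := Λ) (w := wt) hwt
    (C := ENNReal.ofReal C₀) ENNReal.ofReal_ne_top F hinj.injOn (fun c hc i => ?_) (fun c hc => ?_)
  · -- membership in `Λ`
    have hWc : W (h c) ≠ 0 := by
      intro h0; apply hc; show ‖W (gq c)‖ = 0; rw [hWgh c, h0, norm_zero]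
    exact ⟨by simpa only [hF] using row_ne_zero (Γ c) (Fin.castSucc i), hmemSf c hWc i⟩
  · -- the bound
    have hWc : W (h c) ≠ 0 := by
      intro h0; apply hc; show ‖W (gq c)‖ = 0; rw [hWgh c, h0, norm_zero]
    set N : Fin m → ℝ := fun i => ‖vecInfinitePart K (m + 1) (ratVec K (F c i) ᵥ* (x : Matrix (Fin (m + 1)) (Fin (m + 1)) A))‖ with hN
    have hNpos : ∀ i, 0 < N i := fun i =>
      norm_vecInfinitePart_ratVec_vecMul_pos K (row_ne_zero (Γ c) (Fin.castSucc i)) x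
    have hprod_pos : 0 < ∏ i, N i ^ M₀ := Finset.prod_pos fun i _ => pow_pos (hNpos i) _
    -- `‖W‖ ∏ N_i^{M₀} ≤ C₀`
    have h1 : ∏ i, N i ^ M₀ ≤ (((m + 1 : ℕ) : ℝ) * B) ^ (m * M₀) * Rf c ^ (m * M₀) := by
      calc ∏ i, N i ^ M₀ ≤ ∏ _i : Fin m, (((m + 1 : ℕ) : ℝ) * B * Rf c) ^ M₀ :=
            Finset.prod_le_prod (fun i _ => pow_nonneg (hNpos i).le _) fun i _ => pow_le_pow_left₀ (hNpos i).le (hNle c i) _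
        _ = (((m + 1 : ℕ) : ℝ) * B) ^ (m * M₀) * Rf c ^ (m * M₀) := by
            rw [Finset.prod_const, Finset.card_univ, Fintype.card_fin, ← pow_mul, mul_pow, mul_comm M₀ m]
    have h2 : ‖W (h c)‖ * ∏ i, N i ^ M₀ ≤ C₀ := by
      calc ‖W (h c)‖ * ∏ i, N i ^ M₀ ≤ ‖W (h c)‖ * ((((m + 1 : ℕ) : ℝ) * B) ^ (m * M₀) * Rf c ^ (m * M₀)) :=
            mul_le_mul_of_nonneg_left h1 (norm_nonneg _)
        _ = (((m + 1 : ℕ) : ℝ) * B) ^ (m * M₀) * (‖W (h c)‖ * Rf c ^ (m * M₀)) := by ring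
        _ ≤ C₀ := mul_le_mul_of_nonneg_left (hkey c) (by positivity)
    have h3 : ‖W (gq c)‖ ≤ C₀ * ∏ i, N i ^ (-(M₀ : ℝ)) := by
      rw [hWgh c]
      have e1 : ∏ i, N i ^ (-(M₀ : ℝ)) = (∏ i, N i ^ M₀)⁻¹ := by
        rw [← Finset.prod_inv_distrib]
        refine Finset.prod_congr rfl fun i _ => ?_
        rw [Real.rpow_neg (hNpos i).le, Real.rpow_natCast]
      rw [e1, ← div_eq_mul_inv, le_div_iff₀ hprod_pos]
      exact h2
    show ENNReal.ofReal ‖W (gq c)‖ ≤ ENNReal.ofReal C₀ * ∏ i, wt (F c i)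
    calc ENNReal.ofReal ‖W (gq c)‖ ≤ ENNReal.ofReal (C₀ * ∏ i, N i ^ (-(M₀ : ℝ))) := ENNReal.ofReal_le_ofReal h3
      _ = ENNReal.ofReal C₀ * ∏ i, wt (F c i) := by
          rw [ENNReal.ofReal_mul hC₀0, ENNReal.ofReal_prod_of_nonneg fun i _ => Real.rpow_nonneg (hNpos i).le _]

/-- **The Whittaker series of a cusp form on `GL_n(𝔸_K)` is absolutely summable**: for a cusp
form `φ` (Borel–Jacquet conditions for the standard compact level structure, no central character
assumed) and `x ∈ GL_n(𝔸_K)`, `n = m + 1`,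
`∑_{γ ∈ N_m(K)\GL_m(K)} ‖W_φ(diag(γ,1) x)‖ < ∞` (left `GL_n(K)`-invariance, a principal congruence
level inside the level of `φ` — `exists_forall_conj_mem_of_mem_finiteLevelsGL` — and the uniform
archimedean decay `IsCuspFormGL.exists_norm_whittakerDepth_zero_mul_pow_le` feed
`summable_norm_whittakerDepth_glCorner_of_decay`). [cite: CogdellAnalyticTheory2004, Thm. 1.1] -/
theorem IsCuspFormGL.summable_norm_whittakerDepth_glCorner {φ : GL (Fin (m + 1)) (AdeleRing (𝓞 K) K) → ℂ}
    (hφ : IsCuspFormGL (m + 1) K (isCompact_glFiniteIntegralLevel_holds (m + 1) K) φ)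
    (x : GL (Fin (m + 1)) (AdeleRing (𝓞 K) K)) :
    Summable fun γ : Quotient (QuotientGroup.rightRel (upperUnitriangular (Fin m) K)) =>
      ‖whittakerDepth 0 φ (glCorner (AdeleRing (𝓞 K) K) (Nat.le_succ m) (ratGL K γ.out) * x)‖ := by
  -- left invariance under `GL_n(K)`
  have hφK : ∀ (γ₀ : GL (Fin (m + 1)) K) (y : GL (Fin (m + 1)) (AdeleRing (𝓞 K) K)), φ (ratGL K γ₀ * y) = φ y :=
    fun γ₀ y => hφ.1.leftInvariant _ (show _ ∈ rationalPointsGL (m + 1) K from ⟨γ₀, rfl⟩) y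
  -- a principal congruence level inside the level of `φ`
  obtain ⟨U, hU, hφU⟩ := hφ.1.exists_level
  rw [AutomorphyDatum.gl_finiteLevels] at hU
  obtain ⟨𝔫, h𝔫, h𝔫U⟩ := exists_forall_conj_mem_of_mem_finiteLevelsGL hU (Θ := {1}) isCompact_singleton
  have hφU' : ∀ y, ∀ u ∈ principalCongruenceLevel (m + 1) K 𝔫, φ (y * u) = φ y := by
    intro y u hu
    have hmem := h𝔫U 1 (Set.mem_singleton 1) u hu
    rw [inv_one, one_mul, mul_one] at hmem
    exact hφU u hmem y
  haveI : NeZero (m + 1) := ⟨Nat.succ_ne_zero m⟩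
  exact summable_norm_whittakerDepth_glCorner_of_decay hφK h𝔫 hφU' x fun w M l =>
    hφ.exists_norm_whittakerDepth_zero_mul_pow_le x w M l

end Majorant

/-! ### The named fact -/

section Holds

variable {n : ℕ} {K : Type} [Field K] [NumberField K]

/-- **Discharge of `Shalika1974_fourierExpansion_cuspForm`**: the Fourier–Whittaker expansion
`φ(g) = ∑_{γ ∈ N_{n-1}(K)\GL_{n-1}(K)} W_φ(diag(γ,1) g)` of a cusp form on `GL_n(𝔸_K)`, absolutely
convergent (Shalika (1974), Thm. 5.9; Piatetski-Shapiro (1979); Cogdell (2004), Thm. 1.1): the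
reduction `Shalika1974_fourierExpansion_cuspForm_of_summable` (mirabolic Fourier inversion down
the unipotent tower) and the absolute summability `IsCuspFormGL.summable_norm_whittakerDepth_glCorner`
(for `n = 0` the index set is finite). [cite: CogdellAnalyticTheory2004, Thm. 1.1] -/
theorem Shalika1974_fourierExpansion_cuspForm_holds : Shalika1974_fourierExpansion_cuspForm (n := n) (K := K) := by
  refine Shalika1974_fourierExpansion_cuspForm_of_summable ?_
  intro _ _ φ hφ x
  cases n with
  | zero =>
    haveI : IsEmpty (Fin (0 - 1)) := Fin.isEmpty'
    haveI : Subsingleton (GL (Fin (0 - 1)) K) := ⟨fun a b => Units.ext (Subsingleton.elim _ _)⟩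
    exact Summable.of_finite
  | succ m => exact hφ.summable_norm_whittakerDepth_glCorner x

end Holds

end Literature.NumberTheory.Automorphic
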